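/-
Copyright (c) 2026 the pub-hodgecm-mathlib formalisation cell (harness21).  Prover seat hodgecm-mathlib-K2E1-p10 (g3) (E1 hand lent to L4 per K2-lead R40 (2)), Track B ∕ K2-LIT,
h413 = `stmt-HodgeConjecture-24833`, route of record `HCCMUnconditional`, line `K2_E3_EllipticInputs` (L4, (SC-an)₂ cone), deal D144 of LINE-LEAD K2E3-plan (g4) (EMIT #3, 2026-09-04T15:02:09Z):
the `N = 2` twin of ★ [M6] `K2E3SupercuspidalTruncatedCharLimCanc` — LIMIT AND CANCELLATION of the truncated supercuspidal character integrals on `U₂(H)(L⁺_v)`, over ★ Thm20₂ (K2E3-p32 D137),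
★ [M2a]₂ FILE A∕B (K2E3-p31 D136), ★ SingularLocusNull₂ (this seat D139) and the ★ (f2)₂ place model `nonempty_continuousMulEquiv_placeModel_antidiagonal_two_of_isotropic` (K2E3-p11 p860510).
-/
import Summits.HodgeConjecture.HodgeConjecture.Theorems.K2E3SupercuspidalTruncatedCharThm20TwoOfLevelOne  -- ★ [M4]₂ LETTER-FREE p861335 (K2E3-p31): `setIntegral_sdiff_heightBall_coeff_conj_eq_zero` = ★ p861272 with `hT20 :=` ★ p861278 `cuspForm_cancellation_levelOne_U2` (K2E3-p32)
import Summits.HodgeConjecture.HodgeConjecture.Theorems.K2E3TruncatedCharTransport                 -- ★ [M5′] p856751 (rank-free): `exists_compactExhaustion_preimage`, `truncated_eq_inter_and_tendsto_of_map`, `ρ ∘ e⁻¹` smooth ∕ supercuspidal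
import Summits.HodgeConjecture.HodgeConjecture.Theorems.K2E3SupercuspModelFrameAtPlaceCartanTwo    -- ★ [M2a]₂ FILE B (K2E3-p31): (d) `exists_conj_torusU_of_not_isCompact_centralizer`, (f) `exists_isCompact_support_coeff_conj_subset_mul_torusU`; brings ★ FILE A₂ p861132
import Summits.HodgeConjecture.HodgeConjecture.Theorems.K2E3UnitarySingularLocusNullTwo             -- ★ D139 (this seat, p861160): `ae_isRegularElt_of_eq_over_two` (Lemma 42 at `N = 2`)
import Summits.HodgeConjecture.HodgeConjecture.Theorems.K2E3CharLocIntNearSemisimpleNonsplitTwoOfQuasiSplitIdentity  -- ★ p860510 (K2E3-p11): `nonempty_continuousMulEquiv_placeModel_antidiagonal_two_of_isotropic` (the (f2)₂ model `U(σ_w, H_w) ≃ₜ* U(σ_w, Φ₂)`); brings ★ (f2) `isotropic_or_anisotropic` (rank-free)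
import Summits.HodgeConjecture.HodgeConjecture.Theorems.K2E3EllWeightPlaceOfFinConjTwo             -- ★ `over_two_hermitian`, `isUnit_det_over_two`
import Summits.HodgeConjecture.HodgeConjecture.Theorems.K2E3SupercuspOrbitalSliceCuspidalModelTwo     -- ★ p861233 [M1]₂ (K2E3-p37): `continuous_coeff_conj` at `Fin 2`
import Summits.HodgeConjecture.HodgeConjecture.Theorems.K2E3SupercuspidalTruncatedCharLimCanc      -- ★ [M6] (the `N = 3` original): §1 rank-free `exists_coe_eq_univ_of_compactSpace`, `forall_exists_truncated_eq_inter_and_tendsto_of_compactSpace`, `exists_forall_setIntegral_sdiff_eq_zero_of_subset`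
import Summits.HodgeConjecture.HodgeConjecture.Theorems.K2E3HeightBallExhaustion                   -- ★ p856390 (rank-free): `exists_heightBall_compactExhaustion`
import Summits.HodgeConjecture.HodgeConjecture.Theorems.K2E3UnipotentConjTwistBochner              -- ★ p856617: `exists_isCompact_subset_mul_of_isCompact_image_mk` (rank-free)
import Literature.NumberTheory.Automorphic.ConjugationProperOnRegularCompactaLocal                  -- ★ model-level Lemma 14 `UnitaryGroupOfForm.isCompact_image_mk_setOf_exists_conj_mem_of_charpoly_separable` (any `m`)
import Literature.NumberTheory.Automorphic.AdmissibleInvariantFormSchur                             -- ★ `Representation.IsSupercuspidal.hasCompactSupport_sesqForm_apply_apply`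
import Literature.NumberTheory.Automorphic.AnisotropicUnitaryGroupCompactLocal                     -- ★ `UnitaryGroup.compactSpace_local_of_anisotropic` (any `N`), `exists_v_eq_exp_neg_one_adicCompletion`
import Literature.NumberTheory.Automorphic.AdicCompletionLocalField                                 -- ★ instances: `L_w` is a non-archimedean local field
import Literature.NumberTheory.Automorphic.LocalUnitaryGroupCongrMeasure                            -- ★ instances on `(cmDatum L N H).Local v`
import HarnessLib

/-!
# h413 ∕ Track B «K2-LIT», line `K2_E3_EllipticInputs` (L4), D144 — `K2E3SupercuspidalTruncatedCharLimCancTwo`: [M6]₂, LIMIT AND CANCELLATION OF THE TRUNCATED SUPERCUSPIDAL CHARACTER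
# INTEGRALS ON `U₂(H)(L⁺_v)` — `Θₙ(g) = ∫_{Ω n ∩ Ω R(g)}` and `Θₙ(g) → Θ_{R(g)}(g)` for Haar-almost every `g` (Harish-Chandra 1970, Part VII §3 eq. (1); Theorem 20; Lemma 14; Lemma 42)

Cell `pub/hodgecm-mathlib`, crux h413 = `stmt-HodgeConjecture-24833`, route `HCCMUnconditional`; L4 LINE-LEAD K2E3-plan (g4) deal D144 (EMIT #3), chain desk K2E3-p27 (g0) (letter (u8)), consumers:
the (SC-an)₂ payer via ★ `sigSCan_datum_of_bricks L 2 H` (the explicit-radius strengthening is ★ `K2E3SupercuspidalTruncatedCharLimCancExplicitTwo`, K2E3-p31).  THEOREMS ONLY (no `def`, no `instance`, no notation, no named-fact hypothesis, no `sorry`);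
lane `--supports stmt-HodgeConjecture-24833 --as helper` (count-neutral).  Closes no socket.  It is ★ [M6] `K2E3SupercuspidalTruncatedCharLimCanc` (398 l.) with `Fin 3 ↦ Fin 2`, TOKEN FOR
TOKEN: the rank-free §1 (stationary exhaustions of a compact group; shell vanishing from compact support) is REUSED BY NAME from ★ [M6]; §2–§3 are re-typed on the `N = 2` bricks ★ [M4]₂ Thm20₂
(K2E3-p32), ★ [M2a]₂ FILE A∕B (K2E3-p31), ★ SingularLocusNull₂ (this seat), the ★ (f2)₂ place model (K2E3-p11 p860510, composed with ★ `localNonsplitEquiv`) and the rank-free ★ [M5′] transport, ★ height balls, ★ Lemma 14, ★ domination docking.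

THE TARGET (as at `N = 3`).  The two consumers of the (SC-an)₂ letter on `G = (cmDatum L 2 H).Local v` (`v` non-split) read, for the truncated orbital integrals
`Θₙ(g) = ∫_{Ω n} B v₁ (ρ(x g x⁻¹) v₁) dμ(x)` of a supercuspidal coefficient along a compact exhaustion `Ω`, `hlim : ∀ᵐ g, ¬ EllReg g → Θₙ(g) → F g` and
`hcanc : ∀ n, ∀ᵐ g, ¬ EllReg g → Θₙ(g) = ∫_{Ω n ∩ Bset g} …`.  THIS FILE inhabits them at `N = 2`, for EVERY hermitian `H ∈ M₂(L)` with `det H ≠ 0`, every Haar `μ`, every SMOOTH SUPERCUSPIDAL `ρ`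
with a `ρ`-invariant sesquilinear `B` and any `u, u′`, in the GUARD-FREE form **`∃ Ω, ∀ᵐ g ∂μ, ∃ R, (∀ n, Θₙ(g) = ∫_{Ω n ∩ Ω R}) ∧ Θₙ(g) → Θ_R(g)`**, by the dichotomy on `H_w`
(★ (f2) `isotropic_or_anisotropic`): ANISOTROPIC ⇒ `G` compact (★ `UnitaryGroup.compactSpace_local_of_anisotropic`), every exhaustion stationary (★ [M6] §1); ISOTROPIC ⇒ ★ `localNonsplitEquiv` ∘ ★ (f2)₂ place model give
`e : G ≃ₜ* M = U(σ_w, Φ₂)(L_w)`, and on `M` the SHELL VANISHING `∃ R, ∀ n, ∫_{Ω_M n ∖ Ω_M R} θ_M(x m x⁻¹) = 0` holds at every REGULAR `m` (§2): `Z_M(m)` NOT compact ⇒ `m = y t y⁻¹`, `t` regular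
diagonal (★ [M2a]₂ (d)) and Theorem 20 pays (★ [M4]₂, support datum ★ [M2a]₂ (f)); `Z_M(m)` compact ⇒ the integrand is compactly supported (Lemma 14 at the model, compact centre ★ FILE A₂).  «Almost
every» = «`e g` regular» (★ SingularLocusNull₂ `ae_isRegularElt_of_eq_over_two`).  REGULARITY IS NEVER READ ON `G`: the `¬ EllReg` guard is idle.
* §2 **`exists_forall_setIntegral_sdiff_coeff_conj_eq_zero_of_isRegularElt`**, **`ae_exists_truncated_eq_inter_and_tendsto_model`**.
* §3 `exists_exhaustion_ae_truncated_eq_inter_and_tendsto_of_fieldModel`, `forall_exists_truncated_eq_inter_and_tendsto_of_anisotropic`, **`exists_exhaustion_ae_truncated_eq_inter_and_tendsto`** (MAIN),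
  **`exists_exhaustion_limit_localisation`** (the consumers' binders `Ω F Bset hBsetc hlim hcanc`).
* (No §4 here: the docking on ★ `sigSCan_datum_of_bricks L 2 H` is ONE line for the payer — ★ [M6] §4 with `3 ↦ 2`.)
LETTER-FREE: Theorem 20 at `N = 2` is read from ★ `K2E3SupercuspidalTruncatedCharThm20TwoOfLevelOne` (K2E3-p31, = ★ `…Thm20Two` with its letter `hT20 :=` ★ K2E3-p32's
`K2E3CuspFormCancellationU2LevelOne.cuspForm_cancellation_levelOne_U2`, THEOREM 20 on the full level `K₁` of `U(σ_w, Φ₂)(L_w)`); binders = ★ [M6]'s with `3 ↦ 2` (no `hσ`, no `h2` to feed).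
FED-BY (R39): every structural binder is a datum (`H` hermitian with `det H ≠ 0`, `v` with `hns`, Haar `μ`, a smooth supercuspidal `ρ` with invariant `B`) — instantiated e.g. by `H = Φ₂`
(★ `over_two_hermitian`, `isUnit_det_over_two`) at any non-split `v`; no subgroup is asked to be open.

HONEST LABEL: HC_CM is proved only modulo the 7 printed citations (2 remaining named inputs: hLiu418 = `stmt-HodgeConjecture-24832`, h413 = `stmt-HodgeConjecture-24833`) until rung 0
closes; count-neutral helper: after it the (SC-an)₂ letter is ★ MODULO the domination bricks `hball`, `hballE`, `hW` ([M5]₂), NOT proved here.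
References: [HarishChandra1970] Harish-Chandra (van Dijk), *Harmonic Analysis on Reductive p-adic Groups*, LNM 162, Part I §3 Lemma 14, Part V Lemma 42, Part VII §2 Thm 20, §3 eq. (1) pp. 71–72;
[Rogawski1990] Rogawski, *Automorphic Representations of Unitary Groups in Three Variables*, §3.6, §4.9, §12.2 p. 173, §12.5 p. 182, §14.2 p. 232; [PlatonovRapinchuk1994] §3.1 Thm. 3.1, §5.1;
[Folland1995] Folland, *A Course in Abstract Harmonic Analysis*, §2.4.
-/

set_option autoImplicit false
-- the mandated namespace repeats the single-problem summit's segment (`HodgeConjecture.HodgeConjecture`)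
set_option linter.dupNamespace false

noncomputable section

open MeasureTheory Measure Set Filter Topology NumberField IsDedekindDomain
open scoped NNReal ENNReal Pointwise Matrix MatrixGroups WithZero
open ValuativeRel
open Literature.NumberTheory.Automorphic Literature.NumberTheory.Automorphic.UnitaryGroup Literature.NumberTheory.Rogawski1990
open Literature.NumberTheory.GaloisRepresentations
open Summit.HodgeConjecture.HodgeConjecture.Cruxes.H413.K2E3SupercuspidalTruncatedCharLimCanc (exists_coe_eq_univ_of_compactSpace forall_exists_truncated_eq_inter_and_tendsto_of_compactSpace
  exists_forall_setIntegral_sdiff_eq_zero_of_subset)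

namespace Summit.HodgeConjecture.HodgeConjecture.Cruxes.H413.K2E3SupercuspidalTruncatedCharLimCancTwo


/-! ## §2 The quasi-split field model `M = U(σ_w, Φ₂)(L_w)` at a non-split place: shell vanishing at every regular element, and the two shapes a.e. -/

section Model

variable (L : Type) [Field L] [NumberField L] [IsCMField L] {v : HeightOneSpectrum (𝓞 ↥(maximalRealSubfield L))}
  (w : PlacesOver L v) (hw : IsCMField.complexConj L • w.1 = w.1)

/-- **SHELL VANISHING AT EVERY REGULAR ELEMENT OF THE MODEL** `M = U(σ_w, Φ₂)(L_w)`: for `θ_M = B u′ (ρ(·) u)` a coefficient of a smooth SUPERCUSPIDAL `ρ` of `M` (`B` invariant),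
`μ` Haar, `Ω` the height-ball exhaustion (★ p856390's `hmem` `hinv` `hmul`) and `m` REGULAR, ONE radius `R` gives `∫_{Ω n ∖ Ω R} θ_M(x m x⁻¹) dμ(x) = 0` for every `n`.  Two Cartan
types: `Z(m)` NOT compact ⇒ `m = y t y⁻¹`, `t` regular diagonal (★ [M2a] FILE B (d)) and THEOREM 20 pays (★ [M4], support datum ★ FILE B (f), frame ★ FILE A); `Z(m)` compact ⇒
the integrand is supported in the COMPACT `{x ∣ x m x⁻¹ ∈ supp θ_M}` (Lemma 14 at the model ★ `UnitaryGroupOfForm.isCompact_image_mk_setOf_exists_conj_mem_of_charpoly_separable`, ★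
`IsSupercuspidal.hasCompactSupport_sesqForm_apply_apply`, compact centre ★ FILE A) and §1 applies.
[cite: HarishChandra1970, Part VII §2 Theorem 20 p. 70, §3 p. 71 eq. (1); Part I §3 Lemma 14 p. 9] [cite: Rogawski1990, §3.6 pp. 28–31, §4.9 p. 54, §12.2 p. 173] -/
theorem exists_forall_setIntegral_sdiff_coeff_conj_eq_zero_of_isRegularElt {J : Matrix (Fin 2) (Fin 2) (w.1.adicCompletion L)}
    (hJ : J = (StdForm.antidiagonal 2).over (w.1.adicCompletion L))
    [MeasurableSpace ↥(unitaryGroupOfForm (galAdicCompletionMap (L := L) (IsCMField.complexConj L) hw) J)]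
    [BorelSpace ↥(unitaryGroupOfForm (galAdicCompletionMap (L := L) (IsCMField.complexConj L) hw) J)]
    (μ : Measure ↥(unitaryGroupOfForm (galAdicCompletionMap (L := L) (IsCMField.complexConj L) hw) J)) [μ.IsHaarMeasure]
    (Ω : CompactExhaustion ↥(unitaryGroupOfForm (galAdicCompletionMap (L := L) (IsCMField.complexConj L) hw) J)) {ϖ : w.1.adicCompletion L}
    (hϖ : Valued.v ϖ = WithZero.exp (-1 : ℤ))
    (hmem : ∀ (m : ℕ) (g : ↥(unitaryGroupOfForm (galAdicCompletionMap (L := L) (IsCMField.complexConj L) hw) J)), g ∈ Ω m ↔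
      (∀ i j, Valued.v (ϖ ^ m * ((g : GL (Fin 2) (w.1.adicCompletion L)) : Matrix (Fin 2) (Fin 2) (w.1.adicCompletion L)) i j) ≤ 1) ∧
        ∀ i j, Valued.v (ϖ ^ m * (((g : GL (Fin 2) (w.1.adicCompletion L))⁻¹ : GL (Fin 2) (w.1.adicCompletion L)) :
          Matrix (Fin 2) (Fin 2) (w.1.adicCompletion L)) i j) ≤ 1)
    (hinv : ∀ (m : ℕ) (g : ↥(unitaryGroupOfForm (galAdicCompletionMap (L := L) (IsCMField.complexConj L) hw) J)), g ∈ Ω m → g⁻¹ ∈ Ω m)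
    (hmul : ∀ (a b : ℕ) (g h : ↥(unitaryGroupOfForm (galAdicCompletionMap (L := L) (IsCMField.complexConj L) hw) J)), g ∈ Ω a → h ∈ Ω b → g * h ∈ Ω (a + b))
    {V : Type*} [AddCommGroup V] [Module ℂ V]
    (ρ : Representation ℂ ↥(unitaryGroupOfForm (galAdicCompletionMap (L := L) (IsCMField.complexConj L) hw) J) V) (hsm : ρ.IsSmooth) (hsc : ρ.IsSupercuspidal)
    (B : V →ₗ⋆[ℂ] V →ₗ[ℂ] ℂ)
    (hBinv : ∀ (g : ↥(unitaryGroupOfForm (galAdicCompletionMap (L := L) (IsCMField.complexConj L) hw) J)) (x y : V), B (ρ g x) (ρ g y) = B x y) (u u' : V)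
    (m : ↥(unitaryGroupOfForm (galAdicCompletionMap (L := L) (IsCMField.complexConj L) hw) J)) (hreg : IsRegularElt (m : GL (Fin 2) (w.1.adicCompletion L))) :
    ∃ R : ℕ, ∀ n : ℕ, ∫ x in Ω n \ Ω R, B u' (ρ (x * m * x⁻¹) u) ∂μ = 0 := by
  -- the frame of `L_w` and `M` (★ [M2a] FILE A; ★ `AdicCompletionLocalField` instances)
  letI : MeasurableSpace (w.1.adicCompletion L) := borel _
  haveI : BorelSpace (w.1.adicCompletion L) := ⟨rfl⟩
  haveI : SecondCountableTopology (w.1.adicCompletion L) := secondCountableTopology_adicCompletion L w.1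
  haveI : CharZero (w.1.adicCompletion L) := charZero_of_injective_algebraMap (algebraMap L (w.1.adicCompletion L)).injective
  haveI : SecondCountableTopology (GL (Fin 2) (w.1.adicCompletion L)) := secondCountableTopology_gl_adicCompletion L 2 w.1
  haveI : LocallyCompactSpace (GL (Fin 2) (w.1.adicCompletion L)) := locallyCompactSpace_gl_adicCompletion L 2 w.1
  haveI : SigmaCompactSpace (GL (Fin 2) (w.1.adicCompletion L)) := sigmaCompactSpace_of_locallyCompact_secondCountable
  haveI : SecondCountableTopology ↥(unitaryGroupOfForm (galAdicCompletionMap (L := L) (IsCMField.complexConj L) hw) J) :=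
    K2E3SupercuspModelFrameAtPlace.secondCountableTopology_unitaryGroupOfForm_adicCompletion L w _ J
  haveI : LocallyCompactSpace ↥(unitaryGroupOfForm (galAdicCompletionMap (L := L) (IsCMField.complexConj L) hw) J) :=
    K2E3SupercuspModelFrameAtPlaceTwo.locallyCompactSpace_unitaryGroupOfForm_adicCompletion L w hw J
  haveI : μ.IsMulRightInvariant := K2E3SupercuspModelFrameAtPlaceTwo.isMulRightInvariant_of_isHaarMeasure_of_eq_over L w hw hJ μ
  have hσσ : ∀ x, galAdicCompletionMap (L := L) (IsCMField.complexConj L) hw (galAdicCompletionMap (L := L) (IsCMField.complexConj L) hw x) = x :=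
    galAdicCompletionMap_galAdicCompletionMap_of_smul_eq (IsCMField.complexConj L) w (IsCMField.complexConj_ne_one L) hw
  have hσc : Continuous (galAdicCompletionMap (L := L) (IsCMField.complexConj L) hw) := continuous_galAdicCompletionMap L (IsCMField.complexConj L) hw
  have hσv : ∀ x, Valued.v (galAdicCompletionMap (L := L) (IsCMField.complexConj L) hw x) = Valued.v x :=
    fun x => valued_galAdicCompletionMap (L := L) (IsCMField.complexConj L) hw x
  have hZc := K2E3SupercuspModelFrameAtPlaceTwo.isCompact_center_of_eq_over L w hw hJ
  have hZs := K2E3SupercuspModelFrameAtPlaceTwo.exists_coe_eq_scalar_of_mem_center L w hw hJ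
  obtain ⟨ϖ', hϖ'0, hϖ'1, hσϖ'⟩ := K2E3SupercuspModelFrameAtPlace.exists_ne_zero_valuation_lt_one_map_eq L w hw
  by_cases hZ : IsCompact ((Subgroup.centralizer ({m} : Set ↥(unitaryGroupOfForm (galAdicCompletionMap (L := L) (IsCMField.complexConj L) hw) J)) :
      Subgroup ↥(unitaryGroupOfForm (galAdicCompletionMap (L := L) (IsCMField.complexConj L) hw) J)) :
        Set ↥(unitaryGroupOfForm (galAdicCompletionMap (L := L) (IsCMField.complexConj L) hw) J))
  · -- ELLIPTIC type: the integrand `x ↦ θ_M(x m x⁻¹)` is compactly supported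
    subst hJ
    letI : NontriviallyNormedField (w.1.adicCompletion L) := Valued.toNontriviallyNormedField (w.1.adicCompletion L) (WithZero (Multiplicative ℤ))
    have hθ : HasCompactSupport fun g : ↥(unitaryGroupOfForm (galAdicCompletionMap (L := L) (IsCMField.complexConj L) hw)
        ((StdForm.antidiagonal 2).over (w.1.adicCompletion L))) => B u' (ρ g u) :=
      hsc.hasCompactSupport_sesqForm_apply_apply hZc hsm hBinv u u'
    -- Harish-Chandra's Lemma 14 at the model, `K = {m}`, `C = tsupport θ_M`
    have hA := UnitaryGroupOfForm.isCompact_image_mk_setOf_exists_conj_mem_of_charpoly_separable (m := 2) two_ne_zero hσc hσσ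
      (K2E3EllWeightPlaceOfFinConjTwo.over_two_hermitian (galAdicCompletionMap (L := L) (IsCMField.complexConj L) hw))
      K2E3EllWeightPlaceOfFinConjTwo.isUnit_det_over_two m hreg isCompact_singleton
      (Set.singleton_subset_iff.2 (Subgroup.mem_centralizer_singleton_iff.2 rfl)) (fun t' ht' => by rw [Set.mem_singleton_iff.1 ht']; exact hreg) hθ.isCompact
    have hset : {x : ↥(unitaryGroupOfForm (galAdicCompletionMap (L := L) (IsCMField.complexConj L) hw) ((StdForm.antidiagonal 2).over (w.1.adicCompletion L))) |
        ∃ t' ∈ ({m} : Set _), x * t' * x⁻¹ ∈ tsupport fun g : ↥(unitaryGroupOfForm (galAdicCompletionMap (L := L) (IsCMField.complexConj L) hw)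
          ((StdForm.antidiagonal 2).over (w.1.adicCompletion L))) => B u' (ρ g u)} =
        {x | x * m * x⁻¹ ∈ tsupport fun g : ↥(unitaryGroupOfForm (galAdicCompletionMap (L := L) (IsCMField.complexConj L) hw)
          ((StdForm.antidiagonal 2).over (w.1.adicCompletion L))) => B u' (ρ g u)} := by
      ext x; simp only [Set.mem_setOf_eq, Set.mem_singleton_iff, exists_eq_left]
    rw [hset] at hA
    obtain ⟨C, hC, hsub⟩ := K2E3UnipotentConjTwistBochner.exists_isCompact_subset_mul_of_isCompact_image_mk (Subgroup.centralizer {m}) hA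
    -- the support set is closed, inside the compact `C · Z(m)`
    have hScl : IsClosed {x : ↥(unitaryGroupOfForm (galAdicCompletionMap (L := L) (IsCMField.complexConj L) hw) ((StdForm.antidiagonal 2).over (w.1.adicCompletion L))) |
        x * m * x⁻¹ ∈ tsupport fun g : ↥(unitaryGroupOfForm (galAdicCompletionMap (L := L) (IsCMField.complexConj L) hw)
          ((StdForm.antidiagonal 2).over (w.1.adicCompletion L))) => B u' (ρ g u)} :=
      (isClosed_tsupport _).preimage ((continuous_id.mul continuous_const).mul continuous_inv)
    have hScpt := (hC.mul hZ).of_isClosed_subset hScl hsub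
    refine exists_forall_setIntegral_sdiff_eq_zero_of_subset μ Ω _ hScpt fun x hx => ?_
    exact image_eq_zero_of_notMem_tsupport (f := fun g : ↥(unitaryGroupOfForm (galAdicCompletionMap (L := L) (IsCMField.complexConj L) hw)
      ((StdForm.antidiagonal 2).over (w.1.adicCompletion L))) => B u' (ρ g u)) fun hx' => hx hx'
  · -- SPLIT type: `m = y t y⁻¹`, `t` regular diagonal (★ FILE B (d)) — Theorem 20 pays (★ [M4]), with the support datum ★ FILE B (f)
    obtain ⟨y, t, d, hd, htreg, rfl, -⟩ := K2E3SupercuspModelFrameAtPlaceCartanTwo.exists_conj_torusU_of_not_isCompact_centralizer L w hw hJ hreg hZ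
    exact K2E3SupercuspidalTruncatedCharThm20TwoOfLevelOne.setIntegral_sdiff_heightBall_coeff_conj_eq_zero (galAdicCompletionMap (L := L) (IsCMField.complexConj L) hw)
      hσc hσv hJ μ hϖ hϖ'0 hϖ'1 hσϖ' hZs hZc Ω hmem hinv hmul ρ hsm hsc B hBinv u u' t hd htreg
      (K2E3SupercuspModelFrameAtPlaceCartanTwo.exists_isCompact_support_coeff_conj_subset_mul_torusU L w hw hJ ρ hsm hsc B hBinv t hd htreg u u') y

/-- **THE TWO CONSUMER SHAPES HOLD HAAR-ALMOST EVERYWHERE ON THE MODEL** `M = U(σ_w, Φ₂)(L_w)` (`μ` ANY Haar measure, `Ω` the height balls, `θ_M` a smooth supercuspidal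
coefficient): for `μ`-a.e. `m` ONE radius `R` gives `∫_{Ω n} θ_M(x m x⁻¹) = ∫_{Ω n ∩ Ω R} θ_M(x m x⁻¹)` for all `n` AND `∫_{Ω n} → ∫_{Ω R}` — the previous theorem through ★ (f1) §4,
regular elements being of full measure (★ [M2a] FILE A (e), Lemma 42). [cite: HarishChandra1970, Part VII §3 p. 71 eq. (1), p. 72; Part V Lemma 42] [cite: Rogawski1990, §12.5 p. 182] -/
theorem ae_exists_truncated_eq_inter_and_tendsto_model {J : Matrix (Fin 2) (Fin 2) (w.1.adicCompletion L)}
    (hJ : J = (StdForm.antidiagonal 2).over (w.1.adicCompletion L))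
    [MeasurableSpace ↥(unitaryGroupOfForm (galAdicCompletionMap (L := L) (IsCMField.complexConj L) hw) J)]
    [BorelSpace ↥(unitaryGroupOfForm (galAdicCompletionMap (L := L) (IsCMField.complexConj L) hw) J)]
    (μ : Measure ↥(unitaryGroupOfForm (galAdicCompletionMap (L := L) (IsCMField.complexConj L) hw) J)) [μ.IsHaarMeasure]
    (Ω : CompactExhaustion ↥(unitaryGroupOfForm (galAdicCompletionMap (L := L) (IsCMField.complexConj L) hw) J)) {ϖ : w.1.adicCompletion L}
    (hϖ : Valued.v ϖ = WithZero.exp (-1 : ℤ))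
    (hmem : ∀ (m : ℕ) (g : ↥(unitaryGroupOfForm (galAdicCompletionMap (L := L) (IsCMField.complexConj L) hw) J)), g ∈ Ω m ↔
      (∀ i j, Valued.v (ϖ ^ m * ((g : GL (Fin 2) (w.1.adicCompletion L)) : Matrix (Fin 2) (Fin 2) (w.1.adicCompletion L)) i j) ≤ 1) ∧
        ∀ i j, Valued.v (ϖ ^ m * (((g : GL (Fin 2) (w.1.adicCompletion L))⁻¹ : GL (Fin 2) (w.1.adicCompletion L)) :
          Matrix (Fin 2) (Fin 2) (w.1.adicCompletion L)) i j) ≤ 1)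
    (hinv : ∀ (m : ℕ) (g : ↥(unitaryGroupOfForm (galAdicCompletionMap (L := L) (IsCMField.complexConj L) hw) J)), g ∈ Ω m → g⁻¹ ∈ Ω m)
    (hmul : ∀ (a b : ℕ) (g h : ↥(unitaryGroupOfForm (galAdicCompletionMap (L := L) (IsCMField.complexConj L) hw) J)), g ∈ Ω a → h ∈ Ω b → g * h ∈ Ω (a + b))
    {V : Type*} [AddCommGroup V] [Module ℂ V]
    (ρ : Representation ℂ ↥(unitaryGroupOfForm (galAdicCompletionMap (L := L) (IsCMField.complexConj L) hw) J) V) (hsm : ρ.IsSmooth) (hsc : ρ.IsSupercuspidal)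
    (B : V →ₗ⋆[ℂ] V →ₗ[ℂ] ℂ)
    (hBinv : ∀ (g : ↥(unitaryGroupOfForm (galAdicCompletionMap (L := L) (IsCMField.complexConj L) hw) J)) (x y : V), B (ρ g x) (ρ g y) = B x y) (u u' : V) :
    ∀ᵐ m ∂μ, ∃ R : ℕ,
      (∀ n : ℕ, ∫ x in Ω n, B u' (ρ (x * m * x⁻¹) u) ∂μ = ∫ x in Ω n ∩ Ω R, B u' (ρ (x * m * x⁻¹) u) ∂μ) ∧
      Tendsto (fun n : ℕ => ∫ x in Ω n, B u' (ρ (x * m * x⁻¹) u) ∂μ) atTop (𝓝 (∫ x in Ω R, B u' (ρ (x * m * x⁻¹) u) ∂μ)) := by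
  filter_upwards [K2E3UnitarySingularLocusNullTwo.ae_isRegularElt_of_eq_over_two L w hw hJ μ] with m hreg
  obtain ⟨R, hR⟩ := exists_forall_setIntegral_sdiff_coeff_conj_eq_zero_of_isRegularElt L w hw hJ μ Ω hϖ hmem hinv hmul ρ hsm hsc B hBinv u u' m hreg
  have hφ : Continuous fun x : ↥(unitaryGroupOfForm (galAdicCompletionMap (L := L) (IsCMField.complexConj L) hw) J) => B u' (ρ (x * m * x⁻¹) u) :=
    K2E3SupercuspOrbitalSliceCuspidalModelTwo.continuous_coeff_conj (galAdicCompletionMap (L := L) (IsCMField.complexConj L) hw) ρ hsm B m u u'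
  have hmeas : ∀ n : ℕ, MeasurableSet (Ω n : Set ↥(unitaryGroupOfForm (galAdicCompletionMap (L := L) (IsCMField.complexConj L) hw) J)) :=
    fun n => (Ω.isCompact n).measurableSet
  have hint : ∀ n : ℕ, IntegrableOn (fun x : ↥(unitaryGroupOfForm (galAdicCompletionMap (L := L) (IsCMField.complexConj L) hw) J) => B u' (ρ (x * m * x⁻¹) u)) (Ω n) μ :=
    fun n => hφ.continuousOn.integrableOn_compact (Ω.isCompact n)
  exact ⟨R, K2E3RightInvariantSetIntegralVanishing.setIntegral_eq_setIntegral_inter_of_sdiff_eq_zero μ Ω hmeas R _ hint hR,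
    K2E3RightInvariantSetIntegralVanishing.tendsto_setIntegral_of_forall_sdiff_eq_zero μ Ω (fun _ _ h => Ω.subset h) hmeas R _ hint hR⟩

end Model

/-! ## §3 The carrier `G = (cmDatum L 2 H).Local v` = `U₂(H)(L⁺_v)`, `v` non-split: the guard-free a.e. statement and the consumers' binders -/

section Carrier

variable (L : Type) [Field L] [NumberField L] [IsCMField L] (H : Matrix (Fin 2) (Fin 2) L)

/-- **THE ISOTROPIC BRANCH, ALONG A GIVEN FIELD MODEL `e : G ≃ₜ* M = U(σ_w, Φ₂)(L_w)`** (`G = (cmDatum L 2 H).Local v`; `e` ANY isomorphism of topological groups — ★ (f2)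
supplies one when `H_w` is isotropic): with `Ω := e⁻¹(Ω_M)` (★ p856390, ★ [M5′] §1), for `μ`-a.e. `g` ONE radius `R` gives both shapes for `θ = B u′ (ρ(·) u)`.  Previous theorem
on `M` for `ρ_M = ρ ∘ e⁻¹` (★ [M5′] §3) and `e_* μ`, pulled back (Mathlib `ae_of_ae_map`) and transported (★ [M5′] §2); `ρ_M` is GENERALISED in the proof so that every
unification is first order. [cite: HarishChandra1970, Part VII §3 p. 71 eq. (1), p. 72] [cite: PlatonovRapinchuk1994, §5.1] [cite: Folland1995, §2.4] -/
theorem exists_exhaustion_ae_truncated_eq_inter_and_tendsto_of_fieldModel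
    {v : HeightOneSpectrum (𝓞 ↥(maximalRealSubfield L))} (w : PlacesOver L v) (hw : IsCMField.complexConj L • w.1 = w.1)
    [MeasurableSpace ((UnitaryGroup.cmDatum L 2 H).Local v)] [BorelSpace ((UnitaryGroup.cmDatum L 2 H).Local v)]
    (μ : Measure ((UnitaryGroup.cmDatum L 2 H).Local v)) [μ.IsHaarMeasure]
    (e : (UnitaryGroup.cmDatum L 2 H).Local v ≃ₜ*
      ↥(unitaryGroupOfForm (galAdicCompletionMap (L := L) (IsCMField.complexConj L) hw) ((StdForm.antidiagonal 2).over (w.1.adicCompletion L))))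
    {V : Type*} [AddCommGroup V] [Module ℂ V] (ρ : Representation ℂ ((UnitaryGroup.cmDatum L 2 H).Local v) V) (hsm : ρ.IsSmooth) (hsc : ρ.IsSupercuspidal)
    (B : V →ₗ⋆[ℂ] V →ₗ[ℂ] ℂ) (hBinv : ∀ (g : (UnitaryGroup.cmDatum L 2 H).Local v) (x y : V), B (ρ g x) (ρ g y) = B x y) (u u' : V) :
    ∃ Ω : CompactExhaustion ((UnitaryGroup.cmDatum L 2 H).Local v), ∀ᵐ g ∂μ, ∃ R : ℕ,
      (∀ n : ℕ, ∫ x in Ω n, B u' (ρ (x * g * x⁻¹) u) ∂μ = ∫ x in Ω n ∩ Ω R, B u' (ρ (x * g * x⁻¹) u) ∂μ) ∧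
      Tendsto (fun n : ℕ => ∫ x in Ω n, B u' (ρ (x * g * x⁻¹) u) ∂μ) atTop (𝓝 (∫ x in Ω R, B u' (ρ (x * g * x⁻¹) u) ∂μ)) := by
  letI iM : MeasurableSpace ↥(unitaryGroupOfForm (galAdicCompletionMap (L := L) (IsCMField.complexConj L) hw) ((StdForm.antidiagonal 2).over (w.1.adicCompletion L))) :=
    borel _
  haveI : BorelSpace ↥(unitaryGroupOfForm (galAdicCompletionMap (L := L) (IsCMField.complexConj L) hw) ((StdForm.antidiagonal 2).over (w.1.adicCompletion L))) := ⟨rfl⟩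
  haveI : (μ.map e).IsHaarMeasure := ContinuousMulEquiv.isHaarMeasure_map μ e
  haveI : (μ.map e).IsMulRightInvariant := K2E3SupercuspModelFrameAtPlaceTwo.isMulRightInvariant_of_isHaarMeasure_of_eq_over L w hw rfl (μ.map e)
  -- the height balls of `M` (★ p856390) and their pull-back `Ω := e⁻¹ Ω_M` (★ [M5′] §1)
  haveI := compactSpace_integer_adicCompletion L w.1
  obtain ⟨ϖ, hϖ⟩ := exists_v_eq_exp_neg_one_adicCompletion (E := L) w.1
  obtain ⟨ΩM, hmem, -, hinv, hmul, -⟩ := K2E3HeightBallExhaustion.exists_heightBall_compactExhaustion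
    (galAdicCompletionMap (L := L) (IsCMField.complexConj L) hw) ((StdForm.antidiagonal 2).over (w.1.adicCompletion L))
    (continuous_galAdicCompletionMap L (IsCMField.complexConj L) hw) hϖ
  obtain ⟨Ω, hΩ⟩ := K2E3TruncatedCharTransport.exists_compactExhaustion_preimage e.toHomeomorph ΩM
  refine ⟨Ω, ?_⟩
  -- GENERALISATION over the transported datum `ρ_M` (instantiated below at `ρ ∘ e⁻¹`, ★ [M5′] §3)
  suffices key : ∀ ρM : Representation ℂ
      ↥(unitaryGroupOfForm (galAdicCompletionMap (L := L) (IsCMField.complexConj L) hw) ((StdForm.antidiagonal 2).over (w.1.adicCompletion L))) V,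
      ρM.IsSmooth → ρM.IsSupercuspidal → (∀ m (x y : V), B (ρM m x) (ρM m y) = B x y) → (∀ z : (UnitaryGroup.cmDatum L 2 H).Local v, ρM (e z) = ρ z) →
      ∀ᵐ g ∂μ, ∃ R : ℕ,
        (∀ n : ℕ, ∫ x in Ω n, B u' (ρ (x * g * x⁻¹) u) ∂μ = ∫ x in Ω n ∩ Ω R, B u' (ρ (x * g * x⁻¹) u) ∂μ) ∧
        Tendsto (fun n : ℕ => ∫ x in Ω n, B u' (ρ (x * g * x⁻¹) u) ∂μ) atTop (𝓝 (∫ x in Ω R, B u' (ρ (x * g * x⁻¹) u) ∂μ)) by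
    exact key _ (K2E3TruncatedCharTransport.isSmooth_comp_continuousMulEquiv_symm e ρ hsm)
      (K2E3TruncatedCharTransport.isSupercuspidal_comp_continuousMulEquiv_symm e ρ hsc) (fun m x y => hBinv _ x y)
      (fun z => by rw [MonoidHom.comp_apply, MonoidHom.coe_coe, ContinuousMulEquiv.symm_apply_apply])
  intro ρM hsmM hscM hBinvM hρM
  -- §2 on the model, a.e. for the Haar measure `e_* μ`, pulled back along `e` (Mathlib `ae_of_ae_map`)
  have hM := ae_exists_truncated_eq_inter_and_tendsto_model L w hw rfl (μ.map e) ΩM hϖ hmem hinv hmul ρM hsmM hscM B hBinvM u u'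
  filter_upwards [ae_of_ae_map e.continuous.measurable.aemeasurable hM] with g hg
  obtain ⟨R, hcanc, hlim⟩ := hg
  -- transport of the two shapes (★ [M5′] §2) and `ρ_M(e z) = ρ(z)`
  have hT := K2E3TruncatedCharTransport.truncated_eq_inter_and_tendsto_of_map e μ (fun m => B u' (ρM m u)) ΩM Ω hΩ g hcanc hlim
  simp only [hρM] at hT
  exact ⟨R, hT⟩

/-- **THE ANISOTROPIC BRANCH**: if `H_w` is anisotropic, `G = (cmDatum L 2 H).Local v` is COMPACT (★ `compactSpace_local_of_anisotropic`) and for ANY exhaustion, EVERY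
`g` and EVERY integrand ONE radius gives both shapes (§1). [cite: PlatonovRapinchuk1994, §3.1 Thm. 3.1] [cite: Rogawski1990, §14.2 p. 232] -/
theorem forall_exists_truncated_eq_inter_and_tendsto_of_anisotropic
    {v : HeightOneSpectrum (𝓞 ↥(maximalRealSubfield L))} (w : PlacesOver L v) (hw : IsCMField.complexConj L • w.1 = w.1)
    (hanis : ∀ x : Fin 2 → w.1.adicCompletion L,
      UnitaryGroup.hermForm (galAdicCompletionMap (L := L) (IsCMField.complexConj L) hw) (placeForm H w.1) x x = 0 → x = 0)
    [MeasurableSpace ((UnitaryGroup.cmDatum L 2 H).Local v)] (μ : Measure ((UnitaryGroup.cmDatum L 2 H).Local v))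
    (Ω : CompactExhaustion ((UnitaryGroup.cmDatum L 2 H).Local v))
    {E : Type*} [NormedAddCommGroup E] [NormedSpace ℝ E] (ψ : (UnitaryGroup.cmDatum L 2 H).Local v → (UnitaryGroup.cmDatum L 2 H).Local v → E) :
    ∀ g : (UnitaryGroup.cmDatum L 2 H).Local v, ∃ R : ℕ, (∀ n : ℕ, ∫ x in Ω n, ψ g x ∂μ = ∫ x in Ω n ∩ Ω R, ψ g x ∂μ) ∧
      Tendsto (fun n : ℕ => ∫ x in Ω n, ψ g x ∂μ) atTop (𝓝 (∫ x in Ω R, ψ g x ∂μ)) := by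
  haveI : CompactSpace ((UnitaryGroup.cmDatum L 2 H).Local v) :=
    compactSpace_local_of_anisotropic (IsCMField.complexConj L) H v w hw (IsCMField.complexConj_ne_one L) hanis
  exact forall_exists_truncated_eq_inter_and_tendsto_of_compactSpace μ Ω ψ

/-- **[M6] MAIN — LIMIT AND CANCELLATION OF THE TRUNCATED SUPERCUSPIDAL CHARACTER INTEGRALS, HAAR-A.E., GUARD-FREE.**  `H ∈ M₂(L)` hermitian, `det H ≠ 0`, `v`
NON-SPLIT, `μ` Haar on `G = (cmDatum L 2 H).Local v`, `ρ` smooth SUPERCUSPIDAL (no irreducibility) with invariant `B`, `θ = B u′ (ρ(·) u)`: there is a compact exhaustion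
`Ω` of `G` (depending on `(L, H, v)` only) such that for `μ`-a.e. `g` ONE radius `R` gives `∀ n, Θₙ(g) = ∫_{Ω n ∩ Ω R} θ(x g x⁻¹) dμ` AND `Θₙ(g) → Θ_R(g)`
(`Θₙ(g) = ∫_{Ω n} θ(x g x⁻¹) dμ`).  Dichotomy ★ (f2) `isotropic_or_anisotropic` on `H_w`: anisotropic ⇒ previous theorem with Mathlib `CompactExhaustion.choice`; isotropic ⇒
the field model of ★ (f2) and the theorem before.  REGULARITY ON `G` IS NEVER READ.
[cite: HarishChandra1970, Part VII §3 p. 71 eq. (1), p. 72; §2 Theorem 20 p. 70; Part I §3 Lemma 14 p. 9; Part V Lemma 42]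
[cite: Rogawski1990, §3.6 pp. 28–31, §12.2 p. 173, §12.5 p. 182, §14.2 p. 232] [cite: PlatonovRapinchuk1994, §3.1 Thm. 3.1, §5.1] -/
theorem exists_exhaustion_ae_truncated_eq_inter_and_tendsto (hH : (H.map (cmConjRingHom L))ᵀ = H) (hdet : H.det ≠ 0)
    (v : HeightOneSpectrum (𝓞 ↥(maximalRealSubfield L))) (hns : ∀ w : PlacesOver L v, IsCMField.complexConj L • w.1 = w.1)
    [MeasurableSpace ((UnitaryGroup.cmDatum L 2 H).Local v)] [BorelSpace ((UnitaryGroup.cmDatum L 2 H).Local v)]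
    (μ : Measure ((UnitaryGroup.cmDatum L 2 H).Local v)) [μ.IsHaarMeasure]
    {V : Type*} [AddCommGroup V] [Module ℂ V] (ρ : Representation ℂ ((UnitaryGroup.cmDatum L 2 H).Local v) V) (hsm : ρ.IsSmooth) (hsc : ρ.IsSupercuspidal)
    (B : V →ₗ⋆[ℂ] V →ₗ[ℂ] ℂ) (hBinv : ∀ (g : (UnitaryGroup.cmDatum L 2 H).Local v) (x y : V), B (ρ g x) (ρ g y) = B x y) (u u' : V) :
    ∃ Ω : CompactExhaustion ((UnitaryGroup.cmDatum L 2 H).Local v), ∀ᵐ g ∂μ, ∃ R : ℕ,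
      (∀ n : ℕ, ∫ x in Ω n, B u' (ρ (x * g * x⁻¹) u) ∂μ = ∫ x in Ω n ∩ Ω R, B u' (ρ (x * g * x⁻¹) u) ∂μ) ∧
      Tendsto (fun n : ℕ => ∫ x in Ω n, B u' (ρ (x * g * x⁻¹) u) ∂μ) atTop (𝓝 (∫ x in Ω R, B u' (ρ (x * g * x⁻¹) u) ∂μ)) := by
  obtain ⟨w⟩ := (inferInstance : Nonempty (PlacesOver L v))
  have hw : IsCMField.complexConj L • w.1 = w.1 := hns w
  rcases K2E3RankOneIsotropicPhi3Model.isotropic_or_anisotropic (σ := galAdicCompletionMap (L := L) (IsCMField.complexConj L) hw) (placeForm H w.1) with hiso | hanis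
  · -- ISOTROPIC `H_w`: the quasi-split field model (★ (f2))
    obtain ⟨φ⟩ := K2E3CharLocIntNearSemisimpleNonsplitTwoOfQuasiSplitIdentity.nonempty_continuousMulEquiv_placeModel_antidiagonal_two_of_isotropic L H hH hdet w hw hiso
    exact exists_exhaustion_ae_truncated_eq_inter_and_tendsto_of_fieldModel L H w hw μ
      ((localNonsplitEquiv (IsCMField.complexConj L) H (IsCMField.complexConj_ne_one L) w hw).trans φ) ρ hsm hsc B hBinv u u'
  · -- ANISOTROPIC `H_w`: compact group, stationary exhaustion
    exact ⟨CompactExhaustion.choice _, Eventually.of_forall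
      (forall_exists_truncated_eq_inter_and_tendsto_of_anisotropic L H w hw hanis μ _ fun g x => B u' (ρ (x * g * x⁻¹) u))⟩

/-- **[M6] IN THE CONSUMERS' BINDERS — `Ω`, `F`, `Bset`, `hBsetc`, `hlim`, `hcanc`** — TOKEN FOR TOKEN the `hlim` of ★ `…OfTruncated.exists_locallyIntegrable_smoothTrace_eq_of_truncated`
and the `hcanc` (with `hBsetc`) of ★ `…DominationOfBricks.truncatedCharDominated_of_bricks` ∕ `sigSCan_datum_of_bricks` at `N = 3`, `ρ := r.ρ`, `u = u′ := v₁`, from the MAIN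
theorem with `F g := Θ_{R(g)}(g)`, `Bset g := Ω (R g)` for its a.e.-defined radius (`Classical.epsilon`; the guard `¬ (IsRegularElt g ∧ IsCompact Z(g))` is idle).
[cite: HarishChandra1970, Part VII §3 pp. 70–73] [cite: Rogawski1990, §12.2 p. 173, §12.5 p. 182] -/
theorem exists_exhaustion_limit_localisation (hH : (H.map (cmConjRingHom L))ᵀ = H) (hdet : H.det ≠ 0)
    (v : HeightOneSpectrum (𝓞 ↥(maximalRealSubfield L))) (hns : ∀ w : PlacesOver L v, IsCMField.complexConj L • w.1 = w.1)
    [MeasurableSpace ((UnitaryGroup.cmDatum L 2 H).Local v)] [BorelSpace ((UnitaryGroup.cmDatum L 2 H).Local v)]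
    (μ : Measure ((UnitaryGroup.cmDatum L 2 H).Local v)) [μ.IsHaarMeasure]
    {V : Type*} [AddCommGroup V] [Module ℂ V] (ρ : Representation ℂ ((UnitaryGroup.cmDatum L 2 H).Local v) V) (hsm : ρ.IsSmooth) (hsc : ρ.IsSupercuspidal)
    (B : V →ₗ⋆[ℂ] V →ₗ[ℂ] ℂ) (hBinv : ∀ (g : (UnitaryGroup.cmDatum L 2 H).Local v) (x y : V), B (ρ g x) (ρ g y) = B x y) (u u' : V) :
    ∃ (Ω : CompactExhaustion ((UnitaryGroup.cmDatum L 2 H).Local v)) (F : (UnitaryGroup.cmDatum L 2 H).Local v → ℂ)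
      (Bset : (UnitaryGroup.cmDatum L 2 H).Local v → Set ((UnitaryGroup.cmDatum L 2 H).Local v)),
      (∀ g, IsCompact (Bset g)) ∧
      (∀ᵐ g ∂μ, ¬ (IsRegularElt (g.val : GL (Fin 2) (UnitaryGroup.LocalRing L v)) ∧
          IsCompact ((Subgroup.centralizer ({g} : Set ((UnitaryGroup.cmDatum L 2 H).Local v))) : Set ((UnitaryGroup.cmDatum L 2 H).Local v))) →
        Tendsto (fun n => ∫ x in Ω n, B u' (ρ (x * g * x⁻¹) u) ∂μ) atTop (𝓝 (F g))) ∧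
      (∀ n : ℕ, ∀ᵐ g ∂μ, ¬ (IsRegularElt (g.val : GL (Fin 2) (UnitaryGroup.LocalRing L v)) ∧
          IsCompact ((Subgroup.centralizer ({g} : Set ((UnitaryGroup.cmDatum L 2 H).Local v))) : Set ((UnitaryGroup.cmDatum L 2 H).Local v))) →
        ∫ x in Ω n, B u' (ρ (x * g * x⁻¹) u) ∂μ = ∫ x in Ω n ∩ Bset g, B u' (ρ (x * g * x⁻¹) u) ∂μ) := by
  obtain ⟨Ω, hae⟩ := exists_exhaustion_ae_truncated_eq_inter_and_tendsto L H hH hdet v hns μ ρ hsm hsc B hBinv u u'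
  -- the a.e.-defined radius `R g` (`Classical.epsilon`), the limit `F g := Θ_{R g}(g)` and the ball `Bset g := Ω (R g)`
  let P : (UnitaryGroup.cmDatum L 2 H).Local v → ℕ → Prop := fun g R =>
    (∀ n : ℕ, ∫ x in Ω n, B u' (ρ (x * g * x⁻¹) u) ∂μ = ∫ x in Ω n ∩ Ω R, B u' (ρ (x * g * x⁻¹) u) ∂μ) ∧
      Tendsto (fun n : ℕ => ∫ x in Ω n, B u' (ρ (x * g * x⁻¹) u) ∂μ) atTop (𝓝 (∫ x in Ω R, B u' (ρ (x * g * x⁻¹) u) ∂μ))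
  let R : (UnitaryGroup.cmDatum L 2 H).Local v → ℕ := fun g => Classical.epsilon (P g)
  have hR : ∀ g, (∃ R₀ : ℕ, P g R₀) → P g (R g) := fun g hg => Classical.epsilon_spec hg
  refine ⟨Ω, fun g => ∫ x in Ω (R g), B u' (ρ (x * g * x⁻¹) u) ∂μ, fun g => Ω (R g), fun g => Ω.isCompact (R g), ?_, fun n => ?_⟩
  · filter_upwards [hae] with g hg _
    exact (hR g hg).2
  · filter_upwards [hae] with g hg _
    exact (hR g hg).1 n

end Carrier

end Summit.HodgeConjecture.HodgeConjecture.Cruxes.H413.K2E3SupercuspidalTruncatedCharLimCancTwo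

end
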